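import Summits.Ventures.PercRepro.ProfilePointedCircuitClassesStarNineSerA
import Summits.Ventures.PercRepro.ProfilePointedCircuitClassesTwelveSeriesD

/-!
# PercRepro — THE SERIES-PAIR REGIME OF `StarNine` COMPLETED, PART B: THE STRUCTURE OF A SERIES TRIPLE
(p5, gen 57; `proofs/P5-GM1.md` §85)

When a second series pair `{b′, c}` passes through `b′`, the class `{b, b′, c}` is a series class of size `≥ 3`:
`E − b − b′ − c` has rank `ρ − 2` (`rk_erase_three_of_seriesTriple`), so every bi-independent `4`-set contains
EXACTLY ONE of `b, b′, c`, every count is three times its `b`-cell (`card_filter_eq_three_mul_of_seriesTriple`), and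
the `b`-cells are the counts of the minor `N ／ b ∖ b′` — a seven-point rank-4 matroid in which `c` is a COLOOP
(`rk_erase_minor_of_seriesTriple`).  There the complementation `Y ↦ (E − Y) − c` is an involution of the
bi-independent `3`-sets exchanging «through `p`» with «avoiding `p`» for every `p ≠ c`
(`card_filter_eq_card_filter_of_coloop_seven`), which gives (★)₇ at every `(e, f)` avoiding `c`
(`starSeven_of_coloop`) and `out_3(p) = in_3(p)`.  Part C assembles the positions of `{e, f}`.
-/

open scoped Matroid

namespace PercRepro.Cogirth

open Finset ThmH Skew Shadow Profile

open Classical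

variable {α : Type} [DecidableEq α] {N : Matroid α} [N.Finite]

section StarNineSerB

/-- **THE RANK OF `E − b − b′ − c` FOR A SERIES TRIPLE**: `ρ(E − b − b′ − c) + 2 = ρ(E)`. -/
theorem rk_erase_three_of_seriesTriple {b b' c : α} (h : SeriesPair N b b') (h' : SeriesPair N b' c)
    (hbc : b ≠ c) : rk N ((((gr N).erase b).erase b').erase c) + 2 = rk N (gr N) := by
  have hbc' : SeriesPair N b c := h.trans h' hbc
  have hb' : b' ∈ gr N := h.2.1
  have hbb' : b ≠ b' := h.2.2.1
  have hb'c : b' ≠ c := h'.2.2.1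
  have e1 : insert b' ((((gr N).erase b).erase b').erase c) = ((gr N).erase b).erase c := by
    ext a
    simp only [mem_insert, mem_erase]
    constructor
    · rintro (rfl | ⟨hac, _, hab, hag⟩)
      · exact ⟨hb'c, hbb'.symm, hb'⟩
      · exact ⟨hac, hab, hag⟩
    · rintro ⟨hac, hab, hag⟩
      by_cases hab' : a = b'
      · exact Or.inl hab'
      · exact Or.inr ⟨hac, hab', hab, hag⟩
  have hZ : (((gr N).erase b).erase b').erase c ⊆ gr N :=
    (erase_subset _ _).trans ((erase_subset _ _).trans (erase_subset _ _))
  have h2 := rk_insert_eq hb' hZ (M := N)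
  rw [e1] at h2
  have h3 : rk N (((gr N).erase b).erase c) + 1 = rk N (gr N) := hbc'.2.2.2.2.2
  have hnot : b' ∉ clF N ((((gr N).erase b).erase b').erase c) := by
    intro hcl
    have hcl2 : b' ∈ clF N (((gr N).erase b).erase b') := mem_clF_of_subset (erase_subset _ _) hcl
    have h4 := rk_insert_eq hb' ((erase_subset _ _).trans (erase_subset _ _) :
      ((gr N).erase b).erase b' ⊆ gr N) (M := N)
    rw [if_pos hcl2, insert_erase (mem_erase.2 ⟨hbb'.symm, hb'⟩)] at h4
    have h5 := h.2.2.2.1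
    have h6 := h.2.2.2.2.2
    omega
  rw [if_neg hnot] at h2
  omega

/-- **A BI-INDEPENDENT `4`-SET MEETS A SERIES TRIPLE**: on `#E = 9`, `ρ(E) = 5`, no bi-independent `4`-set avoids
`{b, b′, c}` (it would lie in `E − b − b′ − c`, of rank `3`). -/
theorem mem_or_mem_or_mem_of_seriesTriple (hR : rk N (gr N) = 5) {b b' c : α} (h : SeriesPair N b b')
    (h' : SeriesPair N b' c) (hbc : b ≠ c) {W : Finset α} (hW : W ∈ biIndepSets N 4) :
    b ∈ W ∨ b' ∈ W ∨ c ∈ W := by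
  by_contra hcon
  rw [not_or, not_or] at hcon
  obtain ⟨hb, hb', hc⟩ := hcon
  have hWsub : W ⊆ (((gr N).erase b).erase b').erase c := by
    intro a ha
    have hag := (mem_biIndepSets.1 hW).1 ha
    exact mem_erase.2 ⟨fun h => hc (by rw [← h]; exact ha), mem_erase.2 ⟨fun h => hb' (by rw [← h]; exact ha),
      mem_erase.2 ⟨fun h => hb (by rw [← h]; exact ha), hag⟩⟩⟩
  have h1 := rk_mono' (M := N) hWsub
  have h2 := rk_erase_three_of_seriesTriple h h' hbc
  have h3 := (mem_biIndepSets.1 hW).2.2.1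
  have h4 := (mem_biIndepSets.1 hW).2.1
  omega

/-- **EVERY COUNT IS THREE TIMES ITS `b`-CELL**: for a swap-invariant property `P`, on `#E = 9`, `ρ(E) = 5`,
`#{W : P} = 3 · #{W : P, b ∈ W, b′ ∉ W}` — the three cells «through `b`», «through `b′`», «through `c`» partition
the bi-independent `4`-sets and the swaps identify them. -/
theorem card_filter_eq_three_mul_of_seriesTriple (hn : (gr N).card = 9) (hR : rk N (gr N) = 5) {b b' c : α}
    (h : SeriesPair N b b') (h' : SeriesPair N b' c) (hbc : b ≠ c) (P : Finset α → Prop) [DecidablePred P]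
    (hPb : ∀ W, P (insert b' (W.erase b)) ↔ P W) (hPb' : ∀ W, P (insert b (W.erase b')) ↔ P W)
    (hPc : ∀ W, P (insert c (W.erase b)) ↔ P W) (hPc' : ∀ W, P (insert b (W.erase c)) ↔ P W) :
    ((biIndepSets N 4).filter P).card =
      3 * ((biIndepSets N 4).filter (fun W => (P W ∧ b ∈ W) ∧ b' ∉ W)).card := by
  have hn4 : (gr N).card = rk N (gr N) + 4 := by omega
  have hbc' : SeriesPair N b c := h.trans h' hbc
  have hD := card_filter_eq_sum_two (biIndepSets N 4) P b
  have hD2 := card_filter_eq_sum_two (biIndepSets N 4) (fun W => P W ∧ b ∉ W) b'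
  have e1 : (biIndepSets N 4).filter (fun W => P W ∧ b ∈ W) =
      (biIndepSets N 4).filter (fun W => (P W ∧ b ∈ W) ∧ b' ∉ W) := by
    apply filter_congr
    intro W hW
    exact ⟨fun h1 => ⟨h1, not_mem_of_mem_biIndepSets_of_seriesPair h hn4 hW h1.2⟩, fun h1 => h1.1⟩
  have hswap := card_filter_swap_of_seriesPair h 4 P hPb hPb'
  have hswapc := card_filter_swap_of_seriesPair hbc' 4 P hPc hPc'
  have e2 : (biIndepSets N 4).filter (fun W => (P W ∧ b ∉ W) ∧ b' ∉ W) =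
      (biIndepSets N 4).filter (fun W => (P W ∧ b ∉ W) ∧ c ∈ W) := by
    apply filter_congr
    intro W hW
    constructor
    · rintro ⟨⟨hP, hb⟩, hb'⟩
      refine ⟨⟨hP, hb⟩, ?_⟩
      rcases mem_or_mem_or_mem_of_seriesTriple hR h h' hbc hW with h1 | h1 | h1
      · exact absurd h1 hb
      · exact absurd h1 hb'
      · exact h1
    · rintro ⟨⟨hP, hb⟩, hc⟩
      exact ⟨⟨hP, hb⟩, not_mem_of_mem_biIndepSets_of_seriesPair h'.symm hn4 hW hc⟩
  have e3 : (biIndepSets N 4).filter (fun W => (P W ∧ b ∈ W) ∧ c ∉ W) =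
      (biIndepSets N 4).filter (fun W => (P W ∧ b ∈ W) ∧ b' ∉ W) := by
    apply filter_congr
    intro W hW
    constructor
    · rintro ⟨⟨hP, hb⟩, _⟩
      exact ⟨⟨hP, hb⟩, not_mem_of_mem_biIndepSets_of_seriesPair h hn4 hW hb⟩
    · rintro ⟨⟨hP, hb⟩, _⟩
      exact ⟨⟨hP, hb⟩, not_mem_of_mem_biIndepSets_of_seriesPair hbc' hn4 hW hb⟩
  rw [hD, hD2, e1, e2, ← hswapc, e3, ← hswap]
  ring

/-- **THE MINOR `N ／ b ∖ b′` OF A SERIES TRIPLE HAS `c` AS A COLOOP**: `ρ_{N／b∖b′}(E₇ − c) = ρ_{N／b∖b′}(E₇) − 1`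
(with `E₇ = E − b − b′`), on `#E = 9`, `ρ(E) = 5`. -/
theorem rk_erase_minor_of_seriesTriple (hR : rk N (gr N) = 5) {b b' c : α} (h : SeriesPair N b b')
    (h' : SeriesPair N b' c) (hbc : b ≠ c) :
    rk ((N ／ ({b} : Set α)) ＼ ({b'} : Set α)) ((gr ((N ／ ({b} : Set α)) ＼ ({b'} : Set α))).erase c) = 3 := by
  have hrb : rk N {b} = 1 := by
    have := indep_singleton_of_seriesPair h
    have h1 := rk_eq_card_of_indep' (M := N) (X := {b}) (by simpa using this)
    rw [card_singleton] at h1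
    exact h1
  rw [gr_minor_of_seriesPair]
  have hsub : (((gr N).erase b).erase b').erase c ⊆ ((gr N).erase b).erase b' := erase_subset _ _
  have h1 := rk_minor_add_one_of_nonloop (N := N) (s₁ := b') hrb hsub
  have e1 : insert b ((((gr N).erase b).erase b').erase c) = ((gr N).erase b').erase c := by
    ext a
    simp only [mem_insert, mem_erase]
    constructor
    · rintro (rfl | ⟨hac, hab', _, hag⟩)
      · exact ⟨hbc, h.2.2.1, h.1⟩
      · exact ⟨hac, hab', hag⟩
    · rintro ⟨hac, hab', hag⟩
      by_cases hab : a = b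
      · exact Or.inl hab
      · exact Or.inr ⟨hac, hab', hab, hag⟩
  rw [e1] at h1
  have h2 : rk N (((gr N).erase b').erase c) + 1 = rk N (gr N) := h'.2.2.2.2.2
  omega


/-- **THE COLOOP INVOLUTION AT `(7, 4)`**: on a matroid with `#E = 7`, `ρ(E) = 4` and a coloop `c`
(`ρ(E − c) = 3`), the map `Y ↦ (E − Y) − c` is an involution of the bi-independent `3`-sets; for properties `P`, `Q`
exchanged by it, `#{Y : P} = #{Y : Q}`. -/
theorem card_filter_eq_card_filter_of_coloop_seven {M : Matroid α} [M.Finite] (hn : (gr M).card = 7)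
    (hR : rk M (gr M) = 4) {c : α} (hc : c ∈ gr M) (hco : rk M ((gr M).erase c) = 3)
    (P Q : Finset α → Prop) [DecidablePred P] [DecidablePred Q]
    (hPQ : ∀ Y ∈ biIndepSets M 3, (P Y ↔ Q ((gr M \ Y).erase c)))
    (hQP : ∀ Y ∈ biIndepSets M 3, (Q Y ↔ P ((gr M \ Y).erase c))) :
    ((biIndepSets M 3).filter P).card = ((biIndepSets M 3).filter Q).card := by
  -- the involution on the bi-independent `3`-sets
  have hcY : ∀ Y ∈ biIndepSets M 3, c ∉ Y := by
    intro Y hY hcY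
    have hYb := (mem_biIndepSets.1 hY)
    have hsub : gr M \ Y ⊆ (gr M).erase c := by
      intro a ha
      rw [mem_sdiff] at ha
      exact mem_erase.2 ⟨fun h => ha.2 (by rw [h]; exact hcY), ha.1⟩
    have h1 := rk_mono' (M := M) hsub
    have h2 : (gr M \ Y).card = 4 := by rw [card_sdiff_of_subset hYb.1, hn, hYb.2.1]
    have h3 := hYb.2.2.2
    omega
  have hinv : ∀ Y ∈ biIndepSets M 3, (gr M \ Y).erase c ∈ biIndepSets M 3 ∧
      (gr M \ ((gr M \ Y).erase c)).erase c = Y := by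
    intro Y hY
    have hYb := (mem_biIndepSets.1 hY)
    have hcY' := hcY Y hY
    have hcc : c ∈ gr M \ Y := mem_sdiff.2 ⟨hc, hcY'⟩
    have hcompl : gr M \ ((gr M \ Y).erase c) = insert c Y := by
      ext a
      simp only [mem_sdiff, mem_erase, mem_insert, not_and, not_not]
      constructor
      · rintro ⟨hag, h1⟩
        by_cases hac : a = c
        · exact Or.inl hac
        · exact Or.inr (h1 hac hag)
      · rintro (rfl | haY)
        · exact ⟨hc, fun h _ => absurd rfl h⟩
        · exact ⟨hYb.1 haY, fun _ _ => haY⟩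
    have hccl : c ∉ clF M Y := by
      intro hcl
      have hcl2 : c ∈ clF M ((gr M).erase c) :=
        mem_clF_of_subset (fun a ha => mem_erase.2 ⟨fun h => hcY' (by rw [← h]; exact ha), hYb.1 ha⟩) hcl
      have h4 := rk_insert_eq hc (erase_subset _ _ : (gr M).erase c ⊆ gr M) (M := M)
      rw [if_pos hcl2, insert_erase hc, hR, hco] at h4
      omega
    have hrins : rk M (insert c Y) = 4 := by
      rw [rk_insert_eq hc hYb.1, if_neg hccl, hYb.2.2.1, hYb.2.1]
    refine ⟨?_, ?_⟩
    · rw [mem_biIndepSets]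
      refine ⟨(erase_subset _ _).trans sdiff_subset, ?_, ?_, ?_⟩
      · rw [card_erase_of_mem hcc, card_sdiff_of_subset hYb.1, hn, hYb.2.1]
      · exact rk_eq_card_of_subset_of_rk_eq_card (erase_subset _ _) hYb.2.2.2
      · rw [hcompl, hrins, card_insert_of_notMem hcY', hYb.2.1]
    · rw [hcompl, erase_insert hcY']
  apply card_bij (fun Y _ => (gr M \ Y).erase c)
  · intro Y hY
    rw [mem_filter] at hY ⊢
    exact ⟨(hinv Y hY.1).1, (hPQ Y hY.1).1 hY.2⟩
  · intro Y hY Y' hY' heq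
    rw [mem_filter] at hY hY'
    have h1 := (hinv Y hY.1).2
    have h2 := (hinv Y' hY'.1).2
    rw [← h1, ← h2, heq]
  · intro Z hZ
    rw [mem_filter] at hZ
    refine ⟨(gr M \ Z).erase c, ?_, (hinv Z hZ.1).2⟩
    rw [mem_filter]
    refine ⟨(hinv Z hZ.1).1, ?_⟩
    rw [hPQ _ (hinv Z hZ.1).1, (hinv Z hZ.1).2]
    exact hZ.2

/-- **(★)₇ WITH A COLOOP, AS AN IDENTITY**: on `#E = 7`, `ρ(E) = 4` with a coloop `c` and `e, f ∈ E − c`,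
`#{Y ∈ BI_3 : e ∈ Y, f ∉ Y} = #{Y ∈ BI_3 : f ∈ Y, e ∉ Y}`. -/
theorem card_filter_mem_notMem_eq_of_coloop_seven {M : Matroid α} [M.Finite] (hn : (gr M).card = 7)
    (hR : rk M (gr M) = 4) {c e f : α} (hc : c ∈ gr M) (hco : rk M ((gr M).erase c) = 3) (he : e ∈ gr M)
    (hf : f ∈ gr M) (hec : e ≠ c) (hfc : f ≠ c) :
    ((biIndepSets M 3).filter (fun Y => e ∈ Y ∧ f ∉ Y)).card =
      ((biIndepSets M 3).filter (fun Y => f ∈ Y ∧ e ∉ Y)).card := by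
  apply card_filter_eq_card_filter_of_coloop_seven hn hR hc hco
  · intro Y _
    constructor
    · rintro ⟨heY, hfY⟩
      exact ⟨mem_erase.2 ⟨hfc, mem_sdiff.2 ⟨hf, hfY⟩⟩, fun h => (mem_sdiff.1 (mem_erase.1 h).2).2 heY⟩
    · rintro ⟨hfY', heY'⟩
      refine ⟨?_, (mem_sdiff.1 (mem_erase.1 hfY').2).2⟩
      by_contra heY
      exact heY' (mem_erase.2 ⟨hec, mem_sdiff.2 ⟨he, heY⟩⟩)
  · intro Y _
    constructor
    · rintro ⟨hfY, heY⟩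
      exact ⟨mem_erase.2 ⟨hec, mem_sdiff.2 ⟨he, heY⟩⟩, fun h => (mem_sdiff.1 (mem_erase.1 h).2).2 hfY⟩
    · rintro ⟨heY', hfY'⟩
      refine ⟨?_, (mem_sdiff.1 (mem_erase.1 heY').2).2⟩
      by_contra hfY
      exact hfY' (mem_erase.2 ⟨hfc, mem_sdiff.2 ⟨hf, hfY⟩⟩)

/-- **`out_3(p) = in_3(p)` WITH A COLOOP**: on `#E = 7`, `ρ(E) = 4` with a coloop `c` and `p ∈ E − c`, the
bi-independent `3`-sets avoiding `p` are as many as those through `p`. -/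
theorem outCount_three_eq_inCount_three_of_coloop_seven {M : Matroid α} [M.Finite] (hn : (gr M).card = 7)
    (hR : rk M (gr M) = 4) {c p : α} (hc : c ∈ gr M) (hco : rk M ((gr M).erase c) = 3) (hp : p ∈ gr M)
    (hpc : p ≠ c) : outCount M 3 p = inCount M 3 p := by
  unfold outCount inCount
  apply card_filter_eq_card_filter_of_coloop_seven hn hR hc hco
  · intro Y _
    constructor
    · intro hpY
      exact mem_erase.2 ⟨hpc, mem_sdiff.2 ⟨hp, hpY⟩⟩
    · intro hpY'
      exact (mem_sdiff.1 (mem_erase.1 hpY').2).2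
  · intro Y _
    constructor
    · intro hpY hpY'
      exact (mem_sdiff.1 (mem_erase.1 hpY').2).2 hpY
    · intro hpY'
      by_contra hpY
      exact hpY' (mem_erase.2 ⟨hpc, mem_sdiff.2 ⟨hp, hpY⟩⟩)

/-- **(★)₇ WITH A COLOOP**: on `#E = 7`, `ρ(E) = 4` with a coloop `c`, `in_3(e) ≤ in_3(f) + thru_3({e, f})` for
`e ≠ f` in `E − c`. -/
theorem starSeven_of_coloop {M : Matroid α} [M.Finite] (hn : (gr M).card = 7) (hR : rk M (gr M) = 4)
    {c e f : α} (hc : c ∈ gr M) (hco : rk M ((gr M).erase c) = 3) (he : e ∈ gr M) (hf : f ∈ gr M)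
    (hec : e ≠ c) (hfc : f ≠ c) : inCount M 3 e ≤ inCount M 3 f + thruCount M 3 {e, f} := by
  have h1 := card_filter_mem_notMem_eq_of_coloop_seven hn hR hc hco he hf hec hfc
  have hD := card_filter_eq_sum_two (biIndepSets M 3) (fun Y => e ∈ Y) f
  have hF := card_filter_eq_sum_two (biIndepSets M 3) (fun Y => f ∈ Y) e
  have hthru : thruCount M 3 {e, f} = ((biIndepSets M 3).filter (fun Y => e ∈ Y ∧ f ∈ Y)).card := by
    unfold thruCount
    exact congrArg Finset.card (filter_congr (fun Y _ => by rw [insert_subset_iff, singleton_subset_iff]))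
  have hcomm : ((biIndepSets M 3).filter (fun Y => f ∈ Y ∧ e ∈ Y)).card =
      ((biIndepSets M 3).filter (fun Y => e ∈ Y ∧ f ∈ Y)).card :=
    congrArg Finset.card (filter_congr (fun Y _ => and_comm))
  unfold inCount
  rw [hD, hF, hthru, hcomm, h1]
  omega

end StarNineSerB

end PercRepro.Cogirth
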